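import Literature.NumberTheory.EllipticCurves.SzpiroFreyCurveProofs
import Literature.NumberTheory.DiophantineGeometry.ValuationProductElliptic
import HarnessLib

/-!
# The valuation product of a Serre-normalised Frey curve, and small curves with `T > N` (proofs)

Topic `NumberTheory/EllipticCurves`; namespace `Literature.NumberTheory.EllipticCurves`. A proofs
file (theorems only, no definitions), companion of `SzpiroFreyCurveProofs` (discharged Frey facts
`conductorNorm_freyCurve_of_mod_holds`, `minimalDiscriminantNorm_freyCurve_of_mod_holds`:
Bombieri–Gubler Ex. 12.5.10, Serre 1987 §4.1, Masser 1990 Lemma 1) and of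
`Literature.NumberTheory.DiophantineGeometry.ValuationProductElliptic`
(`multiplicativeValuationProduct W = ∏_{p ∥ N} v_p(Δ_min)`).

For the Frey curve `freyCurve a b : y² = x (x - a) (x + b)` in Serre's normalisation
(`a ≡ -1 (mod 4)`, `32 ∣ b`, `a, b` coprime, `m := |ab(a+b)| ≠ 0`):

* `conductorNorm_freyCurve_serre` `N = rad m`; `minimalDiscriminantNorm_freyCurve_serre`
  `2⁸ Δ_min = m²`; `factorization_minimalDiscriminantNorm_freyCurve_serre`
  `v_p(Δ_min) = 2 v_p(m) - 8·[p = 2]`; `multiplicativeValuationProduct_freyCurve_serre`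
  `T = ∏_{p ∣ m} (2 v_p(m) - 8·[p = 2])`; `freyCurve_serre_semistable` (no `p² ∣ N`) and
  `oddMultiplicativePrimes_freyCurve_serre` (the odd multiplicative primes are the odd primes of `m`).
* Explicit small members of the FEW-prime class (`≤ 3` odd multiplicative primes) of the crux
  `FewPrimeValuationProduct` of route ABC/RibetTakahashiSplit (stmt-ABC-1563) whose valuation
  product EXCEEDS the conductor: `13 + 3⁵ = 2⁸` (`freyCurve (-13) 256`: `N = 78`,
  `T = 8·10·2 = 160`) and `3 + 5³ = 2⁷` (`freyCurve 3 (-128)`: `N = 30`, `T = 6·2·6 = 72`); hence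
  `not_fewPrime_multiplicativeValuationProduct_le_conductorNorm`: the explicit strengthening
  "`T(E) ≤ N_E`" (`C = 1`, `ε = 1`) of that crux is false (cdisprove seat, 2026-08-15).

## References

* [BombieriGubler2006] E. Bombieri, W. Gubler, *Heights in Diophantine Geometry*, CUP 2006,
  Example 12.5.10.
* [Masser1990] D. W. Masser, *Note on a conjecture of Szpiro*, Astérisque 183 (1990), Lemma 1.
* [PastenShimura2024] H. Pasten, *Shimura curves and the abc conjecture*, J. Number Theory 254
  (2024), §16 (the product `∏_{p ∣ N^*} v_p(Δ)`).
-/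

noncomputable section

namespace Literature.NumberTheory.EllipticCurves

open Literature.NumberTheory.DiophantineGeometry UniqueFactorizationMonoid WeierstrassCurve

section SerreFrey

variable {a b : ℤ}

/-- Serre-normalised Frey curve: `N = rad |ab(a+b)|` (in `ℕ`). B–G Ex. 12.5.10 (a), via the
discharged `conductorNorm_freyCurve_of_mod_holds`. [cite: BombieriGubler2006, Ex. 12.5.10] -/
theorem conductorNorm_freyCurve_serre (hab : IsCoprime a b) (h0 : a * b * (a + b) ≠ 0)
    (ha : a ≡ -1 [ZMOD 4]) (hb : (32 : ℤ) ∣ b) :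
    (freyCurve a b).conductorNorm ℤ = radical (a * b * (a + b)).natAbs := by
  rw [conductorNorm_freyCurve_of_mod_holds a b hab h0 ha hb, ← Int.radical_natAbs_eq_radical,
    Int.natAbs_natCast]

/-- Serre-normalised Frey curve: `2⁸ Δ_min = |ab(a+b)|²`. B–G Ex. 12.5.10 (a), via the discharged
`minimalDiscriminantNorm_freyCurve_of_mod_holds`. [cite: BombieriGubler2006, Ex. 12.5.10] -/
theorem minimalDiscriminantNorm_freyCurve_serre (hab : IsCoprime a b) (h0 : a * b * (a + b) ≠ 0)
    (ha : a ≡ -1 [ZMOD 4]) (hb : (32 : ℤ) ∣ b) :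
    2 ^ 8 * (freyCurve a b).minimalDiscriminantNorm ℤ = (a * b * (a + b)).natAbs ^ 2 := by
  rw [minimalDiscriminantNorm_freyCurve_of_mod_holds a b hab h0 ha hb, Int.natAbs_pow]

/-- Serre-normalised Frey curve: `v_p(Δ_min) = 2 v_p(|ab(a+b)|) - 8·[p = 2]`. [folklore] -/
theorem factorization_minimalDiscriminantNorm_freyCurve_serre (hab : IsCoprime a b)
    (h0 : a * b * (a + b) ≠ 0) (ha : a ≡ -1 [ZMOD 4]) (hb : (32 : ℤ) ∣ b) (p : ℕ) :
    ((freyCurve a b).minimalDiscriminantNorm ℤ).factorization p =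
      2 * (a * b * (a + b)).natAbs.factorization p - if p = 2 then 8 else 0 := by
  have h : (2 ^ 8 * (freyCurve a b).minimalDiscriminantNorm ℤ).factorization p =
      ((a * b * (a + b)).natAbs ^ 2).factorization p := by
    rw [minimalDiscriminantNorm_freyCurve_serre hab h0 ha hb]
  have hΔ : (freyCurve a b).minimalDiscriminantNorm ℤ ≠ 0 := by
    intro h0'
    have hm : (a * b * (a + b)).natAbs ≠ 0 := Int.natAbs_ne_zero.mpr h0
    have := minimalDiscriminantNorm_freyCurve_serre hab h0 ha hb
    rw [h0', mul_zero] at this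
    exact pow_ne_zero 2 hm this.symm
  rw [Nat.factorization_mul (by positivity) hΔ, Nat.factorization_pow, Nat.factorization_pow] at h
  simp only [Finsupp.add_apply, Finsupp.smul_apply, smul_eq_mul, Nat.prime_two.factorization,
    Finsupp.single_apply] at h
  split_ifs with hp
  · subst hp; simp at h; omega
  · rw [if_neg (Ne.symm hp)] at h; omega

/-- Serre-normalised Frey curve: semistable (no `p² ∣ N`), as `N` is a radical. [folklore] -/
theorem freyCurve_serre_semistable (hab : IsCoprime a b) (h0 : a * b * (a + b) ≠ 0)
    (ha : a ≡ -1 [ZMOD 4]) (hb : (32 : ℤ) ∣ b) :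
    ∀ p : ℕ, p.Prime → ¬ p ^ 2 ∣ (freyCurve a b).conductorNorm ℤ := by
  intro p hp h
  have hsq : Squarefree ((freyCurve a b).conductorNorm ℤ) := by
    rw [conductorNorm_freyCurve_serre hab h0 ha hb]; exact squarefree_radical
  exact Nat.squarefree_iff_prime_squarefree.mp hsq p hp (by simpa [sq] using h)

/-- **`T = ∏_{p ∣ m} (2 v_p(m) - 8·[p = 2])`**, `m = |ab(a+b)|`, for a Serre-normalised Frey curve.
[folklore] -/
theorem multiplicativeValuationProduct_freyCurve_serre (hab : IsCoprime a b)
    (h0 : a * b * (a + b) ≠ 0) (ha : a ≡ -1 [ZMOD 4]) (hb : (32 : ℤ) ∣ b) :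
    multiplicativeValuationProduct (freyCurve a b) =
      ∏ p ∈ (a * b * (a + b)).natAbs.primeFactors,
        (2 * (a * b * (a + b)).natAbs.factorization p - if p = 2 then 8 else 0) := by
  have hN := conductorNorm_freyCurve_serre hab h0 ha hb
  rw [multiplicativeValuationProduct_eq_of_squarefree _ (by rw [hN]; exact squarefree_radical), hN,
    Nat.primeFactors_radical]
  exact Finset.prod_congr rfl fun p _ =>
    factorization_minimalDiscriminantNorm_freyCurve_serre hab h0 ha hb p

/-- The odd multiplicative primes of a Serre-normalised Frey curve are the odd primes of
`|ab(a+b)|`. [folklore] -/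
theorem oddMultiplicativePrimes_freyCurve_serre (hab : IsCoprime a b) (h0 : a * b * (a + b) ≠ 0)
    (ha : a ≡ -1 [ZMOD 4]) (hb : (32 : ℤ) ∣ b) :
    ((freyCurve a b).conductorNorm ℤ).primeFactors.filter
        (fun p => p ≠ 2 ∧ ¬ p ^ 2 ∣ (freyCurve a b).conductorNorm ℤ) =
      (a * b * (a + b)).natAbs.primeFactors.erase 2 := by
  ext p
  rw [Finset.mem_filter, Finset.mem_erase, conductorNorm_freyCurve_serre hab h0 ha hb,
    Nat.primeFactors_radical]
  constructor
  · rintro ⟨h, hp2, -⟩; exact ⟨hp2, h⟩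
  · rintro ⟨hp2, h⟩
    refine ⟨h, hp2, ?_⟩
    have := freyCurve_serre_semistable hab h0 ha hb p (Nat.prime_of_mem_primeFactors h)
    rwa [conductorNorm_freyCurve_serre hab h0 ha hb] at this

end SerreFrey

/-! ## Two small curves whose valuation product exceeds the conductor -/

/-- **`13 + 3⁵ = 2⁸`.** `freyCurve (-13) 256` (`y² = x(x+13)(x+256)`): semistable, bad primes
`{2, 3, 13}` (two odd multiplicative primes), `N = 78`, `T = v₂·v₃·v₁₃ = 8·10·2 = 160 > N`.
[folklore] -/
theorem freyCurve_witness_13_243_256 :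
    (freyCurve (-13) 256).IsElliptic ∧
    (∀ p : ℕ, p.Prime → p ≠ 2 → ¬ p ^ 2 ∣ (freyCurve (-13) 256).conductorNorm ℤ) ∧
    (((freyCurve (-13) 256).conductorNorm ℤ).primeFactors.filter
        (fun p => p ≠ 2 ∧ ¬ p ^ 2 ∣ (freyCurve (-13) 256).conductorNorm ℤ)).card = 2 ∧
    (freyCurve (-13) 256).conductorNorm ℤ = 78 ∧
    multiplicativeValuationProduct (freyCurve (-13) 256) = 160 := by
  have hab : IsCoprime (-13 : ℤ) 256 := by rw [Int.isCoprime_iff_gcd_eq_one]; norm_num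
  have h0 : (-13 : ℤ) * 256 * (-13 + 256) ≠ 0 := by norm_num
  have ha : (-13 : ℤ) ≡ -1 [ZMOD 4] := by decide
  have hb : (32 : ℤ) ∣ 256 := by norm_num
  have hm : ((-13 : ℤ) * 256 * (-13 + 256)).natAbs = 808704 := by norm_num
  have hpf : Nat.primeFactors 808704 = {2, 3, 13} := by
    rw [← Nat.toFinset_factors]
    simp only [Nat.primeFactorsList_ofNat]
    decide
  have hf : ∀ p, Nat.factorization 808704 p =
      List.count p [2, 2, 2, 2, 2, 2, 2, 2, 3, 3, 3, 3, 3, 13] := by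
    intro p
    rw [← Nat.primeFactorsList_count_eq]
    simp only [Nat.primeFactorsList_ofNat]
  refine ⟨isElliptic_freyCurve h0, fun p hp _ => freyCurve_serre_semistable hab h0 ha hb p hp,
    ?_, ?_, ?_⟩
  · rw [oddMultiplicativePrimes_freyCurve_serre hab h0 ha hb, hm, hpf]; decide
  · rw [conductorNorm_freyCurve_serre hab h0 ha hb, hm, Nat.radical_eq_prod_primeFactors, hpf]; decide
  · rw [multiplicativeValuationProduct_freyCurve_serre hab h0 ha hb, hm, hpf]
    simp only [hf]
    decide

/-- **`3 + 5³ = 2⁷`.** `freyCurve 3 (-128)` (`y² = x(x-3)(x-128)`): semistable, bad primes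
`{2, 3, 5}`, `N = 30`, `T = v₂·v₃·v₅ = 6·2·6 = 72 > 2N`. [folklore] -/
theorem freyCurve_witness_3_125_128 :
    (freyCurve 3 (-128)).IsElliptic ∧
    (∀ p : ℕ, p.Prime → p ≠ 2 → ¬ p ^ 2 ∣ (freyCurve 3 (-128)).conductorNorm ℤ) ∧
    (((freyCurve 3 (-128)).conductorNorm ℤ).primeFactors.filter
        (fun p => p ≠ 2 ∧ ¬ p ^ 2 ∣ (freyCurve 3 (-128)).conductorNorm ℤ)).card = 2 ∧
    (freyCurve 3 (-128)).conductorNorm ℤ = 30 ∧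
    multiplicativeValuationProduct (freyCurve 3 (-128)) = 72 := by
  have hab : IsCoprime (3 : ℤ) (-128) := by rw [Int.isCoprime_iff_gcd_eq_one]; norm_num
  have h0 : (3 : ℤ) * (-128) * (3 + (-128)) ≠ 0 := by norm_num
  have ha : (3 : ℤ) ≡ -1 [ZMOD 4] := by decide
  have hb : (32 : ℤ) ∣ (-128) := by norm_num
  have hm : ((3 : ℤ) * (-128) * (3 + (-128))).natAbs = 48000 := by norm_num
  have hpf : Nat.primeFactors 48000 = {2, 3, 5} := by
    rw [← Nat.toFinset_factors]
    simp only [Nat.primeFactorsList_ofNat]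
    decide
  have hf : ∀ p, Nat.factorization 48000 p = List.count p [2, 2, 2, 2, 2, 2, 2, 3, 5, 5, 5] := by
    intro p
    rw [← Nat.primeFactorsList_count_eq]
    simp only [Nat.primeFactorsList_ofNat]
  refine ⟨isElliptic_freyCurve h0, fun p hp _ => freyCurve_serre_semistable hab h0 ha hb p hp,
    ?_, ?_, ?_⟩
  · rw [oddMultiplicativePrimes_freyCurve_serre hab h0 ha hb, hm, hpf]; decide
  · rw [conductorNorm_freyCurve_serre hab h0 ha hb, hm, Nat.radical_eq_prod_primeFactors, hpf]; decide
  · rw [multiplicativeValuationProduct_freyCurve_serre hab h0 ha hb, hm, hpf]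
    simp only [hf]
    decide

/-- The explicit strengthening "`∏_{p ∥ N} v_p(Δ_min) ≤ N`" (`C = 1`, `ε = 1`) of the few-prime
valuation-product bound is false: `T = 160 > 78 = N` for `y² = x(x+13)(x+256)`. [folklore] -/
theorem not_fewPrime_multiplicativeValuationProduct_le_conductorNorm :
    ¬ ∀ (W : WeierstrassCurve ℚ) [W.IsElliptic],
      (∀ p : ℕ, p.Prime → p ≠ 2 → ¬ p ^ 2 ∣ W.conductorNorm ℤ) →
      ((W.conductorNorm ℤ).primeFactors.filter
          (fun p => p ≠ 2 ∧ ¬ p ^ 2 ∣ W.conductorNorm ℤ)).card ≤ 3 →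
      multiplicativeValuationProduct W ≤ W.conductorNorm ℤ := by
  intro h
  obtain ⟨hE, h₁, hcard, hN, hT⟩ := freyCurve_witness_13_243_256
  haveI := hE
  have := h (freyCurve (-13) 256) h₁ (by omega)
  rw [hN, hT] at this
  omega

end Literature.NumberTheory.EllipticCurves
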